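import Summits.AtomisticToContinuum.BoseEinsteinCondensation.Theses.BECDipoleTransport
import Summits.AtomisticToContinuum.BoseEinsteinCondensation.Theorems.BECDipoleTransportTransportToWindowCore
import Summits.AtomisticToContinuum.BoseEinsteinCondensation.Theorems.BECDipoleTransportTransportToWindowTransport
import HarnessLib

/-!
# Route `BECDipoleTransport`, support `TransportToWindow` (stmt-AtomisticToContinuum-14624) —
# the closing theorem

Closes stmt-AtomisticToContinuum-14624: `transportToWindow_proof :
Summit.AtomisticToContinuum.BoseEinsteinCondensation.Theses.BECDipoleTransport.TransportToWindow`
(Leg 1 = `DipoleTransportCost`'s conclusion → Leg 2 = `HoleLinearResponse`'s body → the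
Gaussian-window bound `∃K ∀ε ∃ρ₀ ∀ρ<ρ₀ ∀ᶠn ∃δ ∀ δ-near-minimisers Ψ ∃R ∈ [K/√ρ, 2K/√ρ]:
Σ_{k≠0} e^{-R²p_k²/2} n_Ψ(k) ≤ ε(n+1)`).

Proof (the route's docstring, made honest about measurability): `K, C` from Leg 1; Leg 2 with
`ε/4`; `ρ₀ = min(ρ₁, ρ₂, (ε/4C)²)` so that `C√ρ ≤ ε/4`; eventually `8K/√ρ ≤ L = (N/ρ)^{1/3}` so the
radius `R ≤ 2K/√ρ` of Leg 2 is admissible (`≤ L/4`) in Leg 1; `δ = min(δ₁, δ₂)`. Pointwise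
`|Ψ̄_R(x′)−Ψ̄_R(x)|² ≤ 2|Ψ̄_R(x′)−Ψ̄_R(x)+GΨ̄_R(x)|² + 2|GΨ̄_R(x)|²`; the lower integrals split
because the transport term `G…` is jointly measurable
(`measurable_dipoleTransportTerm`, file `…TransportToWindowTransport`), giving
`∭|Ψ̄_R(x′)−Ψ̄_R(x)|² ≤ 2(ε/4)L³ + 2C√ρL³ ≤ εL³`; the smeared variance bound
`L³Σ_{k≠0}e^{-R²p_k²/2}n_Ψ(k) ≤ (n+1)∭|Ψ̄_R(x′)−Ψ̄_R(x)|²` (`windowBound_gaussian`, file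
`…TransportToWindowCore`) finishes. Also: `L_N → ∞` bookkeeping, measurability of the smeared
slices, and the final `ℝ≥0∞` arithmetic (`window_arith`).

No new definitions. References: the route file (items 14621, 14623, 14624, 14626); LSSY2005 §1.2.
-/

noncomputable section

namespace Summit.AtomisticToContinuum.BoseEinsteinCondensation.Theorems.BECDipoleTransport

open MeasureTheory Filter
open scoped ENNReal ComplexConjugate Topology
open Literature.MathematicalPhysics.QuantumManyBody.BoseGas
open Summit.AtomisticToContinuum.BoseEinsteinCondensation.Theses.BECDipoleTransport

/-- `L_N(ρ) = (N/ρ)^{1/3} → ∞`: eventually `M ≤ L_{n+1}(ρ)`. [folklore] -/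
theorem eventually_le_sideLength_succ {ρ : ℝ} (hρ : 0 < ρ) (M : ℝ) :
    ∀ᶠ n : ℕ in atTop, M ≤ sideLength ρ (n + 1) := by
  have ht : Tendsto (fun N : ℕ => sideLength ρ N) atTop atTop :=
    (tendsto_rpow_atTop (by norm_num : (0 : ℝ) < 1 / 3)).comp
      (tendsto_natCast_atTop_atTop.atTop_div_const hρ)
  exact (ht.comp (tendsto_add_atTop_nat 1)).eventually_ge_atTop M

/-- Final arithmetic of the window bound: from `L³·S ≤ (n+1)·V` and
`V ≤ 2·(ε/4·L³) + 2·(C√ρ·L³)` with `C√ρ ≤ ε/4`, conclude `S ≤ ε(n+1)`. [folklore] -/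
theorem window_arith {L ε C sρ : ℝ} (hL : 0 < L) (hε : 0 ≤ ε) (hCs : 0 ≤ C * sρ)
    (hCρ : C * sρ ≤ ε / 4) (n : ℕ) {S V : ℝ≥0∞}
    (hcore : ENNReal.ofReal (L ^ 3) * S ≤ ((n : ℝ≥0∞) + 1) * V)
    (hV : V ≤ 2 * ENNReal.ofReal (ε / 4 * L ^ 3) + 2 * ENNReal.ofReal (C * sρ * L ^ 3)) :
    S ≤ ENNReal.ofReal (ε * (n + 1)) := by
  have hL3 : 0 < L ^ 3 := by positivity
  have hL3ne : ENNReal.ofReal (L ^ 3) ≠ 0 := by simpa using hL3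
  have hreal : 2 * (ε / 4 * L ^ 3) + 2 * (C * sρ * L ^ 3) ≤ ε * L ^ 3 := by nlinarith
  have hV' : V ≤ ENNReal.ofReal (ε * L ^ 3) := by
    refine hV.trans ?_
    rw [← ENNReal.ofReal_ofNat 2, ← ENNReal.ofReal_mul zero_le_two,
      ← ENNReal.ofReal_mul zero_le_two, ← ENNReal.ofReal_add (by positivity) (by positivity)]
    exact ENNReal.ofReal_le_ofReal hreal
  have hn : ((n : ℝ≥0∞) + 1) = ENNReal.ofReal ((n : ℝ) + 1) := by
    rw [show ((n : ℝ) + 1) = ((n + 1 : ℕ) : ℝ) by push_cast; ring, ENNReal.ofReal_natCast]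
    push_cast
    ring
  have h : ENNReal.ofReal (L ^ 3) * S ≤ ENNReal.ofReal (L ^ 3) * ENNReal.ofReal (ε * (n + 1)) := by
    calc ENNReal.ofReal (L ^ 3) * S ≤ ((n : ℝ≥0∞) + 1) * V := hcore
      _ ≤ ((n : ℝ≥0∞) + 1) * ENNReal.ofReal (ε * L ^ 3) := mul_le_mul' le_rfl hV'
      _ = ENNReal.ofReal (L ^ 3) * ENNReal.ofReal (ε * (n + 1)) := by
        rw [hn, ← ENNReal.ofReal_mul (by positivity), ← ENNReal.ofReal_mul hL3.le]
        congr 1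
        ring
  exact (ENNReal.mul_le_mul_iff_right hL3ne ENNReal.ofReal_ne_top).1 h


/-! ### The closing theorem -/

/-- Measurability of the Gaussian-smeared slice at the first reference point,
`(x, x′, Y) ↦ ∫ η_R(x−z)Ψ(z,Y)dz` (parametric integral of a jointly continuous integrand).
[folklore] -/
theorem measurable_smearSlice_fst {n : ℕ} {Ψ : Config (n + 1) → ℂ} (hΨ : Continuous Ψ) (A R : ℝ) :
    Measurable fun p : Space × Space × Config n =>
      ∫ z : Space, ((A * Real.exp (-(‖p.1 - z‖ ^ 2 / R ^ 2)) : ℝ) : ℂ) *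
        Ψ (Matrix.vecCons z p.2.2) := by
  have hc : Continuous fun q : (Space × Space × Config n) × Space =>
      ((A * Real.exp (-(‖q.1.1 - q.2‖ ^ 2 / R ^ 2)) : ℝ) : ℂ) * Ψ (Matrix.vecCons q.2 q.1.2.2) :=
    (Complex.continuous_ofReal.comp (by fun_prop)).mul
      (hΨ.comp (continuous_snd.matrixVecCons (continuous_snd.comp (continuous_snd.comp continuous_fst))))
  exact (hc.stronglyMeasurable.integral_prod_right' (ν := (volume : Measure Space))).measurable

/-- Measurability of the Gaussian-smeared slice at the second reference point,
`(x, x′, Y) ↦ ∫ η_R(x′−z)Ψ(z,Y)dz`. [folklore] -/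
theorem measurable_smearSlice_snd {n : ℕ} {Ψ : Config (n + 1) → ℂ} (hΨ : Continuous Ψ) (A R : ℝ) :
    Measurable fun p : Space × Space × Config n =>
      ∫ z : Space, ((A * Real.exp (-(‖p.2.1 - z‖ ^ 2 / R ^ 2)) : ℝ) : ℂ) *
        Ψ (Matrix.vecCons z p.2.2) := by
  have hc : Continuous fun q : (Space × Space × Config n) × Space =>
      ((A * Real.exp (-(‖q.1.2.1 - q.2‖ ^ 2 / R ^ 2)) : ℝ) : ℂ) * Ψ (Matrix.vecCons q.2 q.1.2.2) :=
    (Complex.continuous_ofReal.comp (by fun_prop)).mul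
      (hΨ.comp (continuous_snd.matrixVecCons (continuous_snd.comp (continuous_snd.comp continuous_fst))))
  exact (hc.stronglyMeasurable.integral_prod_right' (ν := (volume : Measure Space))).measurable

/-- **`TransportToWindow` (stmt-AtomisticToContinuum-14624).** Leg 1 (`DipoleTransportCost`'s
conclusion: the dipole transport of the smeared slice costs `≤ C√ρ·L³` for every radius
`R ∈ [K/√ρ, L/4]`) and Leg 2 (`HoleLinearResponse`'s body: the smeared slice at `x′` is the
transported slice at `x` up to `εL³`, at some `R ∈ [K/√ρ, 2K/√ρ]`) imply the Gaussian-window bound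
`Σ_{k≠0} e^{-R²p_k²/2} n_Ψ(k) ≤ ε(n+1)`. Proof: `K, C` from Leg 1; Leg 2 with `ε/4`;
`ρ₀ = min(ρ₁, ρ₂, (ε/4C)²)` so that `C√ρ ≤ ε/4`; eventually `8K/√ρ ≤ L` so that `R ≤ 2K/√ρ ≤ L/4`;
`δ = min(δ₁, δ₂)`; then `∭|Ψ̄_R(x′)−Ψ̄_R(x)|² ≤ 2·(ε/4)L³ + 2·C√ρL³ ≤ εL³` (three-slot splitting,
`lintegral_cell3_sq_le_of_add`, using the measurability of the transport term) and the smeared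
variance bound `L³Σ_{k≠0}e^{-R²p_k²/2}n_Ψ(k) ≤ (n+1)∭|Ψ̄_R(x′)−Ψ̄_R(x)|²` (`windowBound_gaussian`).
[folklore] -/
theorem transportToWindow_proof : TransportToWindow := by
  unfold TransportToWindow
  intro v _hv hleg1 hleg2
  obtain ⟨K, hK, C, hC, ρ₁, hρ₁, h1⟩ := hleg1
  refine ⟨K, hK, fun ε hε => ?_⟩
  obtain ⟨ρ₂, hρ₂, h2⟩ := hleg2 K hK (ε / 4) (by positivity)
  refine ⟨min ρ₁ (min ρ₂ ((ε / (4 * C)) ^ 2)), by positivity, fun ρ hρ hρlt => ?_⟩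
  have hρ1 : ρ < ρ₁ := lt_of_lt_of_le hρlt (min_le_left _ _)
  have hρ2 : ρ < ρ₂ := lt_of_lt_of_le hρlt ((min_le_right _ _).trans (min_le_left _ _))
  have hρ3 : ρ < (ε / (4 * C)) ^ 2 :=
    lt_of_lt_of_le hρlt ((min_le_right _ _).trans (min_le_right _ _))
  have hsρ : 0 < Real.sqrt ρ := Real.sqrt_pos.2 hρ
  have hCρ : C * Real.sqrt ρ ≤ ε / 4 := by
    have hlt : Real.sqrt ρ < ε / (4 * C) := by
      rw [Real.sqrt_lt' (by positivity)]
      exact hρ3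
    calc C * Real.sqrt ρ ≤ C * (ε / (4 * C)) := by gcongr
      _ = ε / 4 := by field_simp
  filter_upwards [h1 ρ hρ hρ1, h2 ρ hρ hρ2, eventually_le_sideLength_succ hρ (8 * K / Real.sqrt ρ)]
    with n hn1 hn2 hn3
  obtain ⟨δ₁, hδ₁, hΨ1⟩ := hn1
  obtain ⟨δ₂, hδ₂, hΨ2⟩ := hn2
  refine ⟨min δ₁ δ₂, lt_min hδ₁ hδ₂, fun Ψ hΨ => ?_⟩
  obtain ⟨R, hKR, hRK, hb2⟩ := hΨ2 Ψ (hΨ.trans (add_le_add le_rfl (min_le_right _ _)))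
  have hRpos : 0 < R := by
    by_contra hR
    rw [not_lt] at hR
    have : R * Real.sqrt ρ ≤ 0 := mul_nonpos_of_nonpos_of_nonneg hR hsρ.le
    linarith
  have hLpos : 0 < sideLength ρ (n + 1) := by
    unfold sideLength
    exact Real.rpow_pos_of_pos (div_pos (by exact_mod_cast Nat.succ_pos n) hρ) _
  have hRL : R ≤ sideLength ρ (n + 1) / 4 := by
    have hR2 : R ≤ 2 * K / Real.sqrt ρ := by
      rw [le_div_iff₀ hsρ]
      exact hRK
    have h8 : 2 * K / Real.sqrt ρ = (8 * K / Real.sqrt ρ) / 4 := by ring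
    linarith
  have hb1 := hΨ1 Ψ (hΨ.trans (add_le_add le_rfl (min_le_left _ _))) R hKR hRL
  refine ⟨R, hKR, hRK, ?_⟩
  dsimp only at hb1 hb2 ⊢
  -- the analytic core and the splitting
  have hcore := windowBound_gaussian (n := n) hLpos hRpos Ψ
  have hu := (measurable_smearSlice_snd (n := n) Ψ.contDiff.continuous
    ((Real.pi * R ^ 2)⁻¹ * (Real.sqrt (Real.pi * R ^ 2))⁻¹) R).sub
    (measurable_smearSlice_fst (n := n) Ψ.contDiff.continuous
      ((Real.pi * R ^ 2)⁻¹ * (Real.sqrt (Real.pi * R ^ 2))⁻¹) R)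
  have hc : (2 * Real.pi / sideLength ρ (n + 1)) ≠ 0 := by positivity
  have hG := measurable_dipoleTransportTerm (n := n) Ψ.contDiff
    ((Real.pi * R ^ 2)⁻¹ * (Real.sqrt (Real.pi * R ^ 2))⁻¹) ((ρ * sideLength ρ (n + 1) ^ 3)⁻¹)
    R (2 * Real.pi / sideLength ρ (n + 1)) hRpos.ne' hc
  have hsplit := lintegral_cell3_sq_le_of_add (L := sideLength ρ (n + 1))
    (u := fun x x' Y =>
      (∫ z : Space, (((Real.pi * R ^ 2)⁻¹ * (Real.sqrt (Real.pi * R ^ 2))⁻¹ *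
          Real.exp (-(‖x' - z‖ ^ 2 / R ^ 2)) : ℝ) : ℂ) * Ψ.ψ (Matrix.vecCons z Y)) -
        (∫ z : Space, (((Real.pi * R ^ 2)⁻¹ * (Real.sqrt (Real.pi * R ^ 2))⁻¹ *
          Real.exp (-(‖x - z‖ ^ 2 / R ^ 2)) : ℝ) : ℂ) * Ψ.ψ (Matrix.vecCons z Y)))
    (G := fun x x' Y =>
      ∫ z : Space, ((((Real.pi * R ^ 2)⁻¹ * (Real.sqrt (Real.pi * R ^ 2))⁻¹ *
          Real.exp (-(‖x - z‖ ^ 2 / R ^ 2))) : ℝ) : ℂ) * ∑ j : Fin n,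
        (fderiv ℝ Ψ.ψ (Matrix.vecCons z Y) (Pi.single (Fin.succ j)
          (WithLp.toLp 2 fun i : Fin 3 => (ρ * sideLength ρ (n + 1) ^ 3)⁻¹ * ∑' κ : Fin 3 → ℤ,
            Real.exp (-(R ^ 2 * (2 * Real.pi / sideLength ρ (n + 1)) ^ 2 *
              (∑ l, (κ l : ℝ) ^ 2) / 4)) *
              ((κ i : ℝ) / ((2 * Real.pi / sideLength ρ (n + 1)) * ∑ l, (κ l : ℝ) ^ 2)) *
              (Real.sin ((2 * Real.pi / sideLength ρ (n + 1)) * ∑ l, (κ l : ℝ) * (Y j l - x' l)) -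
                Real.sin ((2 * Real.pi / sideLength ρ (n + 1)) * ∑ l, (κ l : ℝ) * (Y j l - x l))))) +
          ((((ρ * sideLength ρ (n + 1) ^ 3)⁻¹ * ∑' κ : Fin 3 → ℤ,
              Real.exp (-(R ^ 2 * (2 * Real.pi / sideLength ρ (n + 1)) ^ 2 *
                (∑ l, (κ l : ℝ) ^ 2) / 4)) *
              (Real.cos ((2 * Real.pi / sideLength ρ (n + 1)) * ∑ l, (κ l : ℝ) * (Y j l - x' l)) -
                Real.cos ((2 * Real.pi / sideLength ρ (n + 1)) * ∑ l, (κ l : ℝ) * (Y j l - x l)))) /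
              2 : ℝ) : ℂ) * Ψ.ψ (Matrix.vecCons z Y)))
    hu hG hb1 hb2
  exact window_arith hLpos hε.le (by positivity) hCρ n hcore hsplit

end Summit.AtomisticToContinuum.BoseEinsteinCondensation.Theorems.BECDipoleTransport

end
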